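import Literature.MathematicalPhysics.QuantumFieldTheory.Balaban1983to89.Node00.N24ItemsStage13AtThm1CCMWOfStepRSignFreeAllTorusSepCoPH
import Summits.QuantumFields.YangMills.Theorems.BalabanUVNodesK0PrintCubeOfStepTokensR

/-!
# NODE N24 (B2) IN CLOSING POSITION UNDER V19: K1⁷'s θ-KEYED CONSEQUENT (and the registered rung-1 body) AT A FAMILY `F` FROM EXACTLY plan g81's V19 STUB TEXTS READ AT `F`
# — stub 1 ([15] Prop. 8's top step), stub 2′ ([6] Prop. 6 at NODE 00's PRINT-CUBE member `zdCubP (MatA 2) L ρ₀`, some `ρ₀ ≥ 1`), stub 3ᴬ′ (the sign-free |β| box at θ₁₅ᶜᶜᴹ(j),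
# cube-letter generic) — AND ONE CUBE-LETTER-GENERIC, K0-CURRENCY-FREE CHILDREN-UNIFORM HYPOTHESIS (the leaves of N05–N13 and the world binding at the witness
# `θ₁₅ᶜᶜᴹᵂ(j; γ; ε₀, ε₂₉; B₃, B₃', a₀, a₁)`, UNIFORMLY in the letters of Part 14's Literature door)

TRACK A (YM-PLAN §2d, node N24 of 28 = binder B2 `hB : B16.EndStatementBPrinted D.C`), seat `pub-ymgap-dag-n24-c` (R134 fan-out seat, strategy s2; gen 8, Part 19).  Key of record: K1⁷
`StabilityBAtRecordR13SepCoPH` = stmt-QuantumFields-20542 (`∀ F, (∃ θ, Provisos₁₃SepCoPH ∧ guard ∧ Admissible) → ∃ (θ, h), guard ∧ Admissible ∧ EndStatementBPrinted (datum θ h).C ∧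
∃ γ₁ > 0, ∀ γ ∈ ]0, γ₁], ∃ P, 1 ≤ P.K ∧ flow.InInterval γ P.K`); this file `--supports` it as a helper (Summits lane).
WHY.  Plan g81 re-cut K0⁷'s skeleton to V19 (01:16Z 2026-08-28): stub 1 UNCHANGED, stub 2 ↦ 2′ (Prop. 6 on print's cube class `zdCubP (MatA 2) L ρ₀` at SOME big-block size `ρ₀ ≥ 1` —
dag-n21-c PART 2's `h2P`), stub 3ᴬ ↦ 3ᴬ′ (the abs β-box GENERIC in the cube letter `(j, c)`, `c ≤ L^j` — PART 1's `h3A'`); composition `K0PrintCubeOfStepTokensR.record13SepCoPHBody_of_stubs1_2P_3A'`.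
Under V19 the K0 witness sits at the cube letter `(ρ₀+3, (44+4ρ₀L)·L)` that COMES OUT OF stub 2′'s existential, so Part 17's closer (`N24K1ConsequentOfStubsAndChildren`, keyed at
`(3, (44+3L)·L)` on Part 15's door with V18's stub-2 currency `zdCub`, `b9Of`, `a0Of`) no longer matches the skeleton of record letter for letter.  THIS FILE is its V19 twin, and it
removes the K0 currency from the children's side altogether: `hchildren` is keyed on Part 14's LITERATURE door `N24_provisos₁₃SepCoPH_door_theta13OfThm1CCMW_of_gauge9TopStepR_of_betaBoxSignFree_allTorus`
(inputs: window, thresholds, signs, [15] Thm 1's regularity sentence, the floor `c ≤ L^j`, the (9)-token at `(L^j, c)`, the sign-free windowed box of the window edition's β with its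
two letters) at a GENERIC cube letter — so a child lane's uniform delivery is stated once for all cube letters and survives any further re-cut of stub 2's currency that still
supplies a (9)-token at some cube letter (PART 1's generic supplier slot `hS`).  From `h1F ∕ h2PF ∕ h3A'F` (V19's stub texts at `F`) and `hchildren`, K1⁷'s consequent at `F`
follows (§1), and so does the registered rung-1 body (§2).  Proof = open stub 1; PART 2's `gauge9Supplier_of_prop6MemberP` ∘ stub 2′ (cube letter, `B₉`, ceiling `a₁′`, (9)-token);
(8) ⇒ (15) at `a₁′` by dag-n07-e's bridge; 3ᴬ′ there; ONE window-shrinking (§0) + dag-n21-c's transfer to the window edition's β; specialise `hchildren`; Part 14's five-form door.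
So «WHICH CHILD BLOCKS K1⁷» (closing form, V19): the three print stubs (N07 ∕ N05-print-cube ∕ NODE O–N26 generic) and, per child lane, ONE uniform delivery over Part 14's door
letters — N05 `B8LeafOfRecordSubBH`, N06 `B9LeafX (Y9OfRecord …)`, N07 `B11Leaf (Z11OfRecord ζ)`, N08 `PrintedUV3V 2 L`, N09 Lemma 4 + `h09T` (located, non-vacuously, by
dag-n09-w2's `N09AtRecord13SepCoPHLoc.thm3Member_stage13SepCoPH_of_stepsOnLoc`: (181)-covariance and [B11] solvability ON THE BOOKKEEPING SETS, localised (2.9)-support, (I19),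
(F7), [B11] ×3, nesting — Part 18), N10 `B13LeafOfRecord`, N11 (S1ᵀ), N12 `B15Leaf (WOfRecord₁₃ …)` + `hK`, N13 (UV₁₃), and the WORLD's β-box (`0 < w.b`: NODE O's positive lower
bound; upper = the K0 box's `β′`).
A NEW importing module (imports Part 14 + dag-n21-c PART 2).  THEOREMS ONLY, def-free, sorry-free, standard axioms.

WHAT THIS FILE PROVES (3 theorems): §0 `windowLetters_of_absBetaBoxH` (window arithmetic for any `HBeta`); §1 `N24_stabilityBR13SepCoPH_consequent_of_stubs1_2P_3A'_of_childrenUniform`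
(K1⁷'s consequent at `F`); §2 `N24_nodesAtSomeRecordS13PWS_of_stubs1_2P_3A'_of_childrenUniform` (the registered rung-1 body `NodesAtSomeRecord13PWS F`'s text at `N = 2`).

HONEST FRAMING: composition BY NAME; nothing of Bałaban's asserted — the three stub texts and the children-uniform hypothesis are DISPLAYED; K0⁷ ∕ K1⁷ NOT closed; N24 COMPOSITE — no
discharge, no count moved (5∕27), no stub closed; a skeleton re-cut is not progress; one finite T⁴ programme at fixed ε; NOT continuum ∕ ℝ⁴ ∕ OS ∕ mass gap ∕ Clay.
-/

noncomputable section

open scoped Matrix.Norms.L2Operator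

namespace Summit.QuantumFields.YangMills.BalabanUVNodes.N24K1ConsequentOfStubsV19AndChildren

open Literature.MathematicalPhysics.QuantumFieldTheory.Balaban1983to89
open Literature.MathematicalPhysics.QuantumFieldTheory.Balaban1983to89.Node00
open DagBinding T4Continuum T4DatumAssembly FlowStepRuns AveragingRT
open FlowStep (BetaLowerH BetaUpperH)
open Summit.QuantumFields.YangMills.BalabanUVNodes.N07Thm1Top7FromProp8 (variationalThm1RegSepCoP7M_of_prop8TopStep)
open Summit.QuantumFields.YangMills.Theorems.K0PrintCubeOfStepTokensR (gauge9Supplier_of_prop6MemberP)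

variable {F : T4Family}

/-! ## §0. Window arithmetic (generic `HBeta`): an abs box on `]0, γ₀]` gives, on a shrunk window `γ ≤ ½`, the two-sided box with the two letters -/

/-- **ABS BOX ⟹ WINDOWED BOX WITH LETTERS** (for any `β : HBeta`): `−β′ ≤ β ≤ β′` on the boxes `]0, γ₀]^(k+1)`, `γ₀ > 0` ⟹ for `γ := min γ₀ (min ½ (1+β′)⁻¹)`: `0 < γ ≤ ½`, `−(−β′)·γ² ≤ 3`,
`β′·γ² ≤ ¾` and the same box on `]0, γ]^(k+1)` (`0 ≤ β′` read off the non-empty box `]0, γ₀]^1`; dag-n21-c Cʷ′ `windowLettersBox_of_absBetaBox` is the instance at `β₁₃(θ₁₅ᶜᶜᴹ(3))`;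
arithmetic = `exists_window_letters_signFree`).  Elementary bookkeeping behind «γ sufficiently small». [cite: Balaban1987RG1, Thm 1 p.259, §1 p.264 (bookkeeping)] -/
theorem windowLetters_of_absBetaBoxH {β : FlowStep.HBeta} {γ₀ β' : ℝ} (hγ0 : 0 < γ₀) (hlow : BetaLowerH (-β') γ₀ β) (hup : BetaUpperH β' γ₀ β) :
    ∃ γ : ℝ, 0 < γ ∧ γ ≤ 1 / 2 ∧ -(-β') * γ ^ 2 ≤ 3 ∧ β' * γ ^ 2 ≤ 3 / 4 ∧ BetaLowerH (-β') γ β ∧ BetaUpperH β' γ β := by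
  have hv : (fun _ : Fin (0 + 1) => γ₀) ∈ FlowStep.Box γ₀ 0 := FlowStep.mem_box.mpr fun _ => ⟨hγ0, le_rfl⟩
  have hβ' : 0 ≤ β' := by
    have h1 := hlow 0 _ hv
    have h2 := hup 0 _ hv
    linarith
  obtain ⟨γ, hγpos, hγle, hγhalf, hl, hu⟩ := exists_window_letters_signFree hγ0 hβ'
  exact ⟨γ, hγpos, hγhalf, hl, hu, fun k v hv => hlow k v (FlowStep.box_mono hγle k hv), fun k v hv => hup k v (FlowStep.box_mono hγle k hv)⟩

/-! ## §1–§2. `N = 2`, cube letter generic: K1⁷'s consequent and the rung-1 body at `F` from V19's three stub texts at `F` and the cube-letter-generic children-uniform hypothesis -/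

/-- **★★★ K1⁷'s θ-KEYED CONSEQUENT AT THE FAMILY `F` FROM EXACTLY V19's THREE STUB TEXTS AT `F` AND ONE CUBE-LETTER-GENERIC CHILDREN-UNIFORM HYPOTHESIS** — the closing shape of N24 (B2) on the
pointed road UNDER plan g81's skeleton of record V19 (registered on stmt-QuantumFields-20541 01:16Z 2026-08-28): `h1F` ∕ `h2PF` ∕ `h3A'F` are the bodies of the registered stubs
`stub_prop8StepCoP13` ([15] Prop. 8's top step, UNCHANGED) ∕ `stub_prop6MemberB8AtP13` (2′: [6] Prop. 6 at NODE 00's PRINT-CUBE member `zdCubP (MatA 2) L ρ₀` for SOME `ρ₀ ≥ 1`,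
`B₁ ≥ 0`, `c₁ > 0`) ∕ `stub_absBetaBoxAtThm1WitnessCCMGen13` (3ᴬ′: the sign-free |β| box of `β₁₃(θ₁₅ᶜᶜᴹ(j; …))` on some window at EVERY cube letter `(j, c)` with `c ≤ L^j`) READ AT `F`
(texts verbatim as in dag-n21-c PART 2 `K0PrintCubeOfStepTokensR.record13SepCoPHBody_of_stubs1_2P_3A'`); `hchildren` is CUBE-LETTER GENERIC and K0-CURRENCY-FREE: for EVERY cube
letter `(j, c)` with `c ≤ L^j`, every window `0 < γ ≤ ½`, thresholds `ε₀, ε₂₉ > 0`, signs `0 ≤ B₃`, `0 ≤ B₃'`, `0 < a₀`, `0 < a₁`, [15] Thm 1's regularity sentence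
`VariationalThm1RegSepCoP7M F 2 B₃ a₀ a₁`, the floor-carrying (9)-step `Gauge9RegSepTopStepR F 2 suppDom (L^j) c B₃ B₃' a₀ a₁` and the sign-free windowed box of the WINDOW
EDITION's β `betaOfRecord₁₃ F 2 θ₁₅ᶜᶜᴹᵂ(j; γ; …)` with its two letters `−bₗ·γ² ≤ 3`, `β′·γ² ≤ ¾` — EXACTLY the hypotheses of Part 14's Literature door
`N24_provisos₁₃SepCoPH_door_theta13OfThm1CCMW_of_gauge9TopStepR_of_betaBoxSignFree_allTorus` — the children deliver, at the witness `θ₁₅ᶜᶜᴹᵂ(j; γ; ε₀, ε₂₉; B₃, B₃', a₀, a₁)`,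
residual layers `lam8 lam12 lam13 Mstar ops ζ lamW`, a world `w` S-bound to the H-pinned four-pin view, the leaves of N05 ∕ N06 ∕ N07 ∕ N08 ∕ N09 (+ `h09T`) ∕ N10 ∕ N11 (S1ᵀ) ∕
N12 ∕ N13 (UV₁₃) and the WORLD's β-box pair `hlo ∕ hhi` (`0 < w.b`: NODE O's positive lower bound; NOT the K0 box).  PROOF: open stub 1 (`B₃, a₀, a₁`, (8)-top-step); PART 2's `gauge9Supplier_of_prop6MemberP` ∘ stub 2′ gives the cube letter `(j, c) = (ρ₀+3, (44+4ρ₀L)·L)`, `B₉ > 0`,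
a ceiling `0 < a₁′ ≤ a₁` and the (9)-token there (dag-n07-e's (b2) inside); (8) ⇒ [15] Thm 1's sentence at `a₁′` (dag-n07-e's bridge `variationalThm1RegSepCoP7M_of_prop8TopStep`);
3ᴬ′ at that point gives the abs box on some `]0, γ₀]`; ONE window-shrinking (§0 `windowLetters_of_absBetaBoxH`: `γ := min γ₀ (min ½ (1+β′)⁻¹)`, `bₗ := −β′`) and the transfer to the
window edition's β (dag-n21-c `betaLowerH∕betaUpperH_theta13OfThm1CCMW_of_half`); specialise `hchildren`; apply Part 14's `N24_stabilityBR13SepCoPH_thetaShape20_pinX3HS_fourPin_pointed_theta13OfThm1CCMW_of_gauge9TopStepR_of_betaBoxSignFree_allTorus_door`.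
So K1⁷ (stmt-QuantumFields-20542)'s consequent at `F` = THIS THEOREM ∘ (V19's stubs 1 ∕ 2′ ∕ 3ᴬ′ as theorems) ∘ (one cube-letter-generic children-uniform theorem per child lane); its antecedent
`∃ θ, Provisos ∧ …` is not used on this road; V18's closer (Part 17 `N24K1ConsequentOfStubsAndChildren`) is the `(3, (44+3L)·L)`-keyed elder of this one and stays true.
COMPOSITE and CONDITIONAL: every hypothesis displayed; nothing of Bałaban asserted; K0⁷ ∕ K1⁷ NOT closed; no count moved.
[cite: Balaban1989LargeFieldII, Thm 1 p.355, (0.1) pp.355–356, p.391; Balaban1988Convergent, Thm 1 p.262, (3.16)–(3.23) pp.268–270; Balaban1987RG1, Thm 1 p.255, Thm 3 p.264, (0.17)–(0.20) pp.255–256, (1.20)–(1.22) p.264, §1 p.264; Balaban1985Variational, Thm 1 (8)–(9) p.279, (144)–(152) pp.300–301, Prop. 8 p.304; Balaban1985RegularSpaces, Prop. 6 p.99, p.98, Thm 8 (1.146) p.101; Balaban1985UV3, Thm 1 p.257; Balaban1988RG2Cluster, Lemmas 1–3 pp.9–20 (bookkeeping)] -/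
theorem N24_stabilityBR13SepCoPH_consequent_of_stubs1_2P_3A'_of_childrenUniform
    (h1F : ∃ B₃ a₀ a₁ : ℝ, 2 * (F.L : ℝ) ^ 2 ≤ B₃ ∧ 0 < a₀ ∧ 0 < a₁ ∧
      Prop8RegSepTopStep F 2 (fun ν K Ω => suppDomOfRecord F ν K Ω) B₃ a₀ a₁)
    (h2PF : ∃ (ρ₀ : ℕ) (B₁ c₁ : ℝ), 1 ≤ ρ₀ ∧ 0 ≤ B₁ ∧ 0 < c₁ ∧
      (letI : CStarAlgebra (MatA 2) := {}; B8.Prop6Printed 4 (F.L : ℝ) B₁ c₁ (fun i : B8LeafModelZd.ZdIdx 4 F.L => zdCubP (MatA 2) F.L ρ₀ i)))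
    (h3A'F : ∀ (j c : ℕ) (B₃ B₃' a₀ a₁ : ℝ), c ≤ F.L ^ j → 2 * (F.L : ℝ) ^ 2 ≤ B₃ → 0 < B₃' → 0 < a₀ → 0 < a₁ →
      VariationalThm1RegSepCoP7M F 2 B₃ a₀ a₁ →
      Gauge9RegSepTopStepR F 2 (fun ν K Ω => suppDomOfRecord F ν K Ω) (F.L ^ j) c B₃ B₃' a₀ a₁ →
      ∃ γ₀ ε₀ ε₂₉ β' : ℝ, 0 < γ₀ ∧ 0 < ε₀ ∧ 0 < ε₂₉ ∧
        BetaLowerH (-β') γ₀ (betaOfRecord₁₃ F 2 (theta13OfThm1CCM F 2 j ε₀ ε₂₉ B₃ B₃' a₀ a₁)) ∧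
        BetaUpperH β' γ₀ (betaOfRecord₁₃ F 2 (theta13OfThm1CCM F 2 j ε₀ ε₂₉ B₃ B₃' a₀ a₁)))
    (hchildren : ∀ {j c : ℕ} {γ ε₀ ε₂₉ B₃ B₃' a₀ a₁ : ℝ} (hγ₀ : 0 < γ) (hγh : γ ≤ 1 / 2) (hε : 0 < ε₀) (hε' : 0 < ε₂₉) (hB : 0 ≤ B₃) (hB' : 0 ≤ B₃') (ha₀ : 0 < a₀) (ha₁ : 0 < a₁) (h15 : VariationalThm1RegSepCoP7M F 2 B₃ a₀ a₁) (hc : c ≤ F.L ^ j) (h9 : Gauge9RegSepTopStepR F 2 (fun ν K Ω => suppDomOfRecord F ν K Ω) (F.L ^ j) c B₃ B₃' a₀ a₁) {bl β' : ℝ} (hbox : BetaLowerH bl γ (betaOfRecord₁₃ F 2 (theta13OfThm1CCMW F 2 j γ ε₀ ε₂₉ B₃ B₃' a₀ a₁))) (hbox' : BetaUpperH β' γ (betaOfRecord₁₃ F 2 (theta13OfThm1CCMW F 2 j γ ε₀ ε₂₉ B₃ B₃' a₀ a₁))) (hl : -bl * γ ^ 2 ≤ 3) (hβ' : β' * γ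 ^ 2 ≤ 3 / 4),
      ∃ (lam8 : ResidB8 (theta13OfThm1CCMW F 2 j γ ε₀ ε₂₉ B₃ B₃' a₀ a₁).toStage3Params) (lam12 : ResidB12 F 2 (theta13OfThm1CCMW F 2 j γ ε₀ ε₂₉ B₃ B₃' a₀ a₁).τ9.M) (lam13 : B12.RunParams → ResidB13 (theta13OfThm1CCMW F 2 j γ ε₀ ε₂₉ B₃ B₃' a₀ a₁).toStage3Params) (Mstar : ℕ) (ops : OpsY 2 (theta13OfThm1CCMW F 2 j γ ε₀ ε₂₉ B₃ B₃' a₀ a₁).toStage3Params Mstar) (ζ : ResidZ F 2) (lamW : ResidW F 2) (w : WorldP),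
        (w.C = (datumOfRecord₁₃SepCoPH F 2 (Stage13HParams.ofHistoryBlind F 2 ⟨theta13OfThm1CCMW F 2 j γ ε₀ ε₂₉ B₃ B₃' a₀ a₁, ZrOfRecord₁₃ F 2 (theta13OfThm1CCMW F 2 j γ ε₀ ε₂₉ B₃ B₃' a₀ a₁)⟩) (N24_provisos₁₃SepCoPH_door_theta13OfThm1CCMW_of_gauge9TopStepR_of_betaBoxSignFree_allTorus hγ₀ hγh hε hε' hB hB' ha₀ ha₁ h15 hc h9 hbox hbox' hl hβ')).C) ∧
        (0 < w.γ ∧ w.γ ≤ (theta13OfThm1CCMW F 2 j γ ε₀ ε₂₉ B₃ B₃' a₀ a₁).γ) ∧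
        (w.L = ((theta13OfThm1CCMW F 2 j γ ε₀ ε₂₉ B₃ B₃' a₀ a₁).L : ℝ)) ∧
        (∀ P, w.up P = upOfRecord₅CS F 2 (((Stage13HParams.ofHistoryBlind F 2 ⟨theta13OfThm1CCMW F 2 j γ ε₀ ε₂₉ B₃ B₃' a₀ a₁, ZrOfRecord₁₃ F 2 (theta13OfThm1CCMW F 2 j γ ε₀ ε₂₉ B₃ B₃' a₀ a₁)⟩).pinX3H F 2 lam8 lam12 lam13).view₁₃CoPHB10YZW F 2 Mstar ops ζ lamW) P) ∧
        (B8LeafOfRecordSubBH (theta13OfThm1CCMW F 2 j γ ε₀ ε₂₉ B₃ B₃' a₀ a₁).toStage3Params lam8) ∧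
        (B9LeafX (Y9OfRecord 2 (theta13OfThm1CCMW F 2 j γ ε₀ ε₂₉ B₃ B₃' a₀ a₁).toStage3Params Mstar ops)) ∧
        (B11Leaf (Z11OfRecord F 2 ζ)) ∧
        (PrintedUV3V 2 (theta13OfThm1CCMW F 2 j γ ε₀ ε₂₉ B₃ B₃' a₀ a₁).L) ∧
        (∀ P : B12.RunParams, B12Sec2to5.Lemma4Printed (F12OfRecord₁₂ F 2 (theta13OfThm1CCMW F 2 j γ ε₀ ε₂₉ B₃ B₃' a₀ a₁).toStage12Params lam12 P) (lam12 P).consts) ∧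
        (∀ P : B12.RunParams, (leavesP w P).smallCouplings → (leavesP w P).smallFieldInductive) ∧
        (∀ P : B12.RunParams, B13LeafOfRecord (theta13OfThm1CCMW F 2 j γ ε₀ ε₂₉ B₃ B₃' a₀ a₁).toStage3Params (lam13 P)) ∧
        (∀ P : B12.RunParams, (leavesP w P).b7 → (leavesP w P).b8 → (leavesP w P).b9 → (leavesP w P).b10 → (leavesP w P).b11 →
      (leavesP w P).smallCouplings → (leavesP w P).smallFieldInductive → (leavesP w P).flowControl →
        ∀ k, k < P.K → SLaw₁₃CoPH F 2 (Stage13HParams.ofHistoryBlind F 2 ⟨theta13OfThm1CCMW F 2 j γ ε₀ ε₂₉ B₃ B₃' a₀ a₁, ZrOfRecord₁₃ F 2 (theta13OfThm1CCMW F 2 j γ ε₀ ε₂₉ B₃ B₃' a₀ a₁)⟩) P k → TLaw₁₃CoPH F 2 (Stage13HParams.ofHistoryBlind F 2 ⟨theta13OfThm1CCMW F 2 j γ ε₀ ε₂₉ B₃ B₃' a₀ a₁, ZrOfRecord₁₃ F 2 (theta13OfThm1CCMW F 2 j γ ε₀ ε₂₉ B₃ B₃' a₀ a₁)⟩) P k)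 ∧
        (∀ P : B12.RunParams, B15Leaf (WOfRecord₁₃ F 2 (theta13OfThm1CCMW F 2 j γ ε₀ ε₂₉ B₃ B₃' a₀ a₁) lamW P)) ∧
        (∀ P : B12.RunParams, (genFlow (betaOfRecord₁₃ F 2 (theta13OfThm1CCMW F 2 j γ ε₀ ε₂₉ B₃ B₃' a₀ a₁)) P.g0).InInterval w.γ P.K → ∀ k, k ≤ P.K → SLaw₁₃CoPH F 2 (Stage13HParams.ofHistoryBlind F 2 ⟨theta13OfThm1CCMW F 2 j γ ε₀ ε₂₉ B₃ B₃' a₀ a₁, ZrOfRecord₁₃ F 2 (theta13OfThm1CCMW F 2 j γ ε₀ ε₂₉ B₃ B₃' a₀ a₁)⟩) P k →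
      ∀ U : GaugeField (F.P P.K) k (SU 2),
        chiβOfRecord₁₃ F 2 (theta13OfThm1CCMW F 2 j γ ε₀ ε₂₉ B₃ B₃' a₀ a₁) P.K (gOfRecord₁₃ F 2 (theta13OfThm1CCMW F 2 j γ ε₀ ε₂₉ B₃ B₃' a₀ a₁) P) k U *
              Real.exp (-(1 / (gOfRecord₁₃ F 2 (theta13OfThm1CCMW F 2 j γ ε₀ ε₂₉ B₃ B₃' a₀ a₁) P k) ^ 2 * wilsonBGOfRecord F 2 (theta13OfThm1CCMW F 2 j γ ε₀ ε₂₉ B₃ B₃' a₀ a₁).εbg P k U)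
                - w.em (gOfRecord₁₃ F 2 (theta13OfThm1CCMW F 2 j γ ε₀ ε₂₉ B₃ B₃' a₀ a₁) P k) * (Fintype.card (Site (F.P P.K) k) : ℝ)) ≤ densOfRecord₁₃ F 2 (theta13OfThm1CCMW F 2 j γ ε₀ ε₂₉ B₃ B₃' a₀ a₁) P k U ∧
        densOfRecord₁₃ F 2 (theta13OfThm1CCMW F 2 j γ ε₀ ε₂₉ B₃ B₃' a₀ a₁) P k U ≤ Real.exp (w.ep (gOfRecord₁₃ F 2 (theta13OfThm1CCMW F 2 j γ ε₀ ε₂₉ B₃ B₃' a₀ a₁) P k) * (Fintype.card (Site (F.P P.K) k) : ℝ))) ∧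
        (BetaLowerH w.b w.γ (betaOfRecord₁₃ F 2 (theta13OfThm1CCMW F 2 j γ ε₀ ε₂₉ B₃ B₃' a₀ a₁))) ∧
        (BetaUpperH w.βup w.γ (betaOfRecord₁₃ F 2 (theta13OfThm1CCMW F 2 j γ ε₀ ε₂₉ B₃ B₃' a₀ a₁)))) :
    ∃ (θ' : Stage13HParams F 2) (h' : θ'.Provisos₁₃SepCoPH F 2), (θ'.ZhUnity F 2 ∧ θ'.SlotsNondegenerate₁₃ F 2) ∧ θ'.Admissible F 2 ∧
      B16.EndStatementBPrinted (datumOfRecord₁₃SepCoPH F 2 θ' h').C ∧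
      ∃ γ₁ : ℝ, 0 < γ₁ ∧ ∀ γ : ℝ, 0 < γ → γ ≤ γ₁ → ∃ P : B12.RunParams, 1 ≤ P.K ∧ ((datumOfRecord₁₃SepCoPH F 2 θ' h').C P).flow.InInterval γ P.K := by
  obtain ⟨B₃, a₀, a₁, hB₃, ha₀, ha₁, h8⟩ := h1F
  have hL0 : (0 : ℝ) < (F.L : ℝ) := by exact_mod_cast lt_trans Nat.zero_lt_one F.hL.2
  have hBpos : (0 : ℝ) < B₃ := lt_of_lt_of_le (mul_pos two_pos (pow_pos hL0 2)) hB₃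
  obtain ⟨j, c, B₉, a₁', hc, hB9, ha₁', ha₁'le, h9⟩ := gauge9Supplier_of_prop6MemberP F h2PF B₃ a₀ a₁ hB₃ ha₀ ha₁ h8
  have h15 : VariationalThm1RegSepCoP7M F 2 B₃ a₀ a₁' := variationalThm1RegSepCoP7M_of_prop8TopStep hBpos (h8.of_le le_rfl ha₁'le)
  obtain ⟨γ₀, ε₀, ε₂₉, β', hγ0, hε, hε', hlow, hup⟩ := h3A'F j c B₃ B₉ a₀ a₁' hc hB₃ hB9 ha₀ ha₁' h15 h9
  obtain ⟨γ, hγpos, hγh, hl, hu, hlow', hup'⟩ := windowLetters_of_absBetaBoxH hγ0 hlow hup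
  have hloW := betaLowerH_theta13OfThm1CCMW_of_half (F := F) (N := 2) (j := j) (ε₀ := ε₀) (ε₂₉ := ε₂₉) (B₃ := B₃) (B₃' := B₉) (a₀ := a₀) (a₁ := a₁') hγh hlow'
  have hupW := betaUpperH_theta13OfThm1CCMW_of_half (F := F) (N := 2) (j := j) (ε₀ := ε₀) (ε₂₉ := ε₂₉) (B₃ := B₃) (B₃' := B₉) (a₀ := a₀) (a₁ := a₁') hγh hup'
  obtain ⟨lam8, lam12, lam13, Mstar, ops, ζ, lamW, w, hC, hγ, hL, hupv, h05, h06, h07, h08, h09, h09T, h10, h11, h12, hUV, hlo, hhi⟩ :=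
    hchildren hγpos hγh hε hε' hBpos.le hB9.le ha₀ ha₁' h15 hc h9 hloW hupW hl hu
  exact N24_stabilityBR13SepCoPH_thetaShape20_pinX3HS_fourPin_pointed_theta13OfThm1CCMW_of_gauge9TopStepR_of_betaBoxSignFree_allTorus_door hγpos hγh hε hε' hBpos.le hB9.le ha₀ ha₁' h15 hc h9 hloW hupW hl hu lam8 lam12 lam13 Mstar ops ζ lamW w hC hγ hL hupv h05 h06 h07 h08 h09 h09T h10 h11 h12 hUV hlo hhi

/-- **★★ RUNG 1's BODY (`NodesAtSomeRecord13PWS F`'s text at `N = 2`) AT THE FAMILY `F` FROM EXACTLY V19's THREE STUB TEXTS AT `F` AND ONE CUBE-LETTER-GENERIC CHILDREN-UNIFORM HYPOTHESIS** — the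
pointed road UNDER plan g81's skeleton of record V19 (registered on stmt-QuantumFields-20541 01:16Z 2026-08-28): `h1F` ∕ `h2PF` ∕ `h3A'F` are the bodies of the registered stubs
`stub_prop8StepCoP13` ([15] Prop. 8's top step, UNCHANGED) ∕ `stub_prop6MemberB8AtP13` (2′: [6] Prop. 6 at NODE 00's PRINT-CUBE member `zdCubP (MatA 2) L ρ₀` for SOME `ρ₀ ≥ 1`,
`B₁ ≥ 0`, `c₁ > 0`) ∕ `stub_absBetaBoxAtThm1WitnessCCMGen13` (3ᴬ′: the sign-free |β| box of `β₁₃(θ₁₅ᶜᶜᴹ(j; …))` on some window at EVERY cube letter `(j, c)` with `c ≤ L^j`) READ AT `F`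
(texts verbatim as in dag-n21-c PART 2 `K0PrintCubeOfStepTokensR.record13SepCoPHBody_of_stubs1_2P_3A'`); `hchildren` is CUBE-LETTER GENERIC and K0-CURRENCY-FREE: for EVERY cube
letter `(j, c)` with `c ≤ L^j`, every window `0 < γ ≤ ½`, thresholds `ε₀, ε₂₉ > 0`, signs `0 ≤ B₃`, `0 ≤ B₃'`, `0 < a₀`, `0 < a₁`, [15] Thm 1's regularity sentence
`VariationalThm1RegSepCoP7M F 2 B₃ a₀ a₁`, the floor-carrying (9)-step `Gauge9RegSepTopStepR F 2 suppDom (L^j) c B₃ B₃' a₀ a₁` and the sign-free windowed box of the WINDOW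
EDITION's β `betaOfRecord₁₃ F 2 θ₁₅ᶜᶜᴹᵂ(j; γ; …)` with its two letters `−bₗ·γ² ≤ 3`, `β′·γ² ≤ ¾` — EXACTLY the hypotheses of Part 14's Literature door
`N24_provisos₁₃SepCoPH_door_theta13OfThm1CCMW_of_gauge9TopStepR_of_betaBoxSignFree_allTorus` — the children deliver, at the witness `θ₁₅ᶜᶜᴹᵂ(j; γ; ε₀, ε₂₉; B₃, B₃', a₀, a₁)`,
residual layers `lam8 lam12 lam13 Mstar ops ζ lamW`, a world `w` S-bound to the H-pinned four-pin view, the leaves of N05 ∕ N06 ∕ N07 ∕ N08 ∕ N09 (+ `h09T`) ∕ N10 ∕ N11 (S1ᵀ) ∕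
N12 ∕ N13 (UV₁₃) (+ `hK`; no β-box: rung 1).  PROOF: open stub 1 (`B₃, a₀, a₁`, (8)-top-step); PART 2's `gauge9Supplier_of_prop6MemberP` ∘ stub 2′ gives the cube letter `(j, c) = (ρ₀+3, (44+4ρ₀L)·L)`, `B₉ > 0`,
a ceiling `0 < a₁′ ≤ a₁` and the (9)-token there (dag-n07-e's (b2) inside); (8) ⇒ [15] Thm 1's sentence at `a₁′` (dag-n07-e's bridge `variationalThm1RegSepCoP7M_of_prop8TopStep`);
3ᴬ′ at that point gives the abs box on some `]0, γ₀]`; ONE window-shrinking (§0 `windowLetters_of_absBetaBoxH`: `γ := min γ₀ (min ½ (1+β′)⁻¹)`, `bₗ := −β′`) and the transfer to the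
window edition's β (dag-n21-c `betaLowerH∕betaUpperH_theta13OfThm1CCMW_of_half`); specialise `hchildren`; apply Part 14's rung-1 form `N24_nodesAtSomeRecordS₁₃SepCoPH_of_pinX3HS_fourPin_pointed_theta13OfThm1CCMW_of_gauge9TopStepR_of_betaBoxSignFree_allTorus_door`.
So K1⁷'s registered rung-1 body at `F` = THIS THEOREM ∘ (V19's stubs as theorems) ∘ (one children-uniform theorem per child lane).
COMPOSITE and CONDITIONAL: every hypothesis displayed; nothing of Bałaban asserted; K0⁷ ∕ K1⁷ NOT closed; no count moved.
[cite: Balaban1989LargeFieldII, Thm 1 p.355, (0.1) pp.355–356, p.391; Balaban1988Convergent, Thm 1 p.262, (3.16)–(3.23) pp.268–270; Balaban1987RG1, Thm 1 p.255, Thm 3 p.264, (0.17)–(0.20) pp.255–256, (1.20)–(1.22) p.264, §1 p.264; Balaban1985Variational, Thm 1 (8)–(9) p.279, (144)–(152) pp.300–301, Prop. 8 p.304; Balaban1985RegularSpaces, Prop. 6 p.99, p.98, Thm 8 (1.146) p.101; Balaban1985UV3, Thm 1 p.257; Balaban1988RG2Cluster, Lemmas 1–3 pp.9–20 (bookkeeping)]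 -/
theorem N24_nodesAtSomeRecordS13PWS_of_stubs1_2P_3A'_of_childrenUniform
    (h1F : ∃ B₃ a₀ a₁ : ℝ, 2 * (F.L : ℝ) ^ 2 ≤ B₃ ∧ 0 < a₀ ∧ 0 < a₁ ∧
      Prop8RegSepTopStep F 2 (fun ν K Ω => suppDomOfRecord F ν K Ω) B₃ a₀ a₁)
    (h2PF : ∃ (ρ₀ : ℕ) (B₁ c₁ : ℝ), 1 ≤ ρ₀ ∧ 0 ≤ B₁ ∧ 0 < c₁ ∧
      (letI : CStarAlgebra (MatA 2) := {}; B8.Prop6Printed 4 (F.L : ℝ) B₁ c₁ (fun i : B8LeafModelZd.ZdIdx 4 F.L => zdCubP (MatA 2) F.L ρ₀ i)))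
    (h3A'F : ∀ (j c : ℕ) (B₃ B₃' a₀ a₁ : ℝ), c ≤ F.L ^ j → 2 * (F.L : ℝ) ^ 2 ≤ B₃ → 0 < B₃' → 0 < a₀ → 0 < a₁ →
      VariationalThm1RegSepCoP7M F 2 B₃ a₀ a₁ →
      Gauge9RegSepTopStepR F 2 (fun ν K Ω => suppDomOfRecord F ν K Ω) (F.L ^ j) c B₃ B₃' a₀ a₁ →
      ∃ γ₀ ε₀ ε₂₉ β' : ℝ, 0 < γ₀ ∧ 0 < ε₀ ∧ 0 < ε₂₉ ∧
        BetaLowerH (-β') γ₀ (betaOfRecord₁₃ F 2 (theta13OfThm1CCM F 2 j ε₀ ε₂₉ B₃ B₃' a₀ a₁)) ∧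
        BetaUpperH β' γ₀ (betaOfRecord₁₃ F 2 (theta13OfThm1CCM F 2 j ε₀ ε₂₉ B₃ B₃' a₀ a₁)))
    (hchildren : ∀ {j c : ℕ} {γ ε₀ ε₂₉ B₃ B₃' a₀ a₁ : ℝ} (hγ₀ : 0 < γ) (hγh : γ ≤ 1 / 2) (hε : 0 < ε₀) (hε' : 0 < ε₂₉) (hB : 0 ≤ B₃) (hB' : 0 ≤ B₃') (ha₀ : 0 < a₀) (ha₁ : 0 < a₁) (h15 : VariationalThm1RegSepCoP7M F 2 B₃ a₀ a₁) (hc : c ≤ F.L ^ j) (h9 : Gauge9RegSepTopStepR F 2 (fun ν K Ω => suppDomOfRecord F ν K Ω) (F.L ^ j) c B₃ B₃' a₀ a₁) {bl β' : ℝ} (hbox : BetaLowerH bl γ (betaOfRecord₁₃ F 2 (theta13OfThm1CCMW F 2 j γ ε₀ ε₂₉ B₃ B₃' a₀ a₁))) (hbox' : BetaUpperH β' γ (betaOfRecord₁₃ F 2 (theta13OfThm1CCMW F 2 j γ ε₀ ε₂₉ B₃ B₃' a₀ a₁))) (hl : -bl * γ ^ 2 ≤ 3) (hβ' : β' * γ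 ^ 2 ≤ 3 / 4),
      ∃ (lam8 : ResidB8 (theta13OfThm1CCMW F 2 j γ ε₀ ε₂₉ B₃ B₃' a₀ a₁).toStage3Params) (lam12 : ResidB12 F 2 (theta13OfThm1CCMW F 2 j γ ε₀ ε₂₉ B₃ B₃' a₀ a₁).τ9.M) (lam13 : B12.RunParams → ResidB13 (theta13OfThm1CCMW F 2 j γ ε₀ ε₂₉ B₃ B₃' a₀ a₁).toStage3Params) (Mstar : ℕ) (ops : OpsY 2 (theta13OfThm1CCMW F 2 j γ ε₀ ε₂₉ B₃ B₃' a₀ a₁).toStage3Params Mstar) (ζ : ResidZ F 2) (lamW : ResidW F 2) (w : WorldP),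
        (w.C = (datumOfRecord₁₃SepCoPH F 2 (Stage13HParams.ofHistoryBlind F 2 ⟨theta13OfThm1CCMW F 2 j γ ε₀ ε₂₉ B₃ B₃' a₀ a₁, ZrOfRecord₁₃ F 2 (theta13OfThm1CCMW F 2 j γ ε₀ ε₂₉ B₃ B₃' a₀ a₁)⟩) (N24_provisos₁₃SepCoPH_door_theta13OfThm1CCMW_of_gauge9TopStepR_of_betaBoxSignFree_allTorus hγ₀ hγh hε hε' hB hB' ha₀ ha₁ h15 hc h9 hbox hbox' hl hβ')).C) ∧
        (0 < w.γ ∧ w.γ ≤ (theta13OfThm1CCMW F 2 j γ ε₀ ε₂₉ B₃ B₃' a₀ a₁).γ) ∧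
        (w.L = ((theta13OfThm1CCMW F 2 j γ ε₀ ε₂₉ B₃ B₃' a₀ a₁).L : ℝ)) ∧
        (∀ P, w.up P = upOfRecord₅CS F 2 (((Stage13HParams.ofHistoryBlind F 2 ⟨theta13OfThm1CCMW F 2 j γ ε₀ ε₂₉ B₃ B₃' a₀ a₁, ZrOfRecord₁₃ F 2 (theta13OfThm1CCMW F 2 j γ ε₀ ε₂₉ B₃ B₃' a₀ a₁)⟩).pinX3H F 2 lam8 lam12 lam13).view₁₃CoPHB10YZW F 2 Mstar ops ζ lamW) P) ∧
        (B8LeafOfRecordSubBH (theta13OfThm1CCMW F 2 j γ ε₀ ε₂₉ B₃ B₃' a₀ a₁).toStage3Params lam8) ∧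
        (B9LeafX (Y9OfRecord 2 (theta13OfThm1CCMW F 2 j γ ε₀ ε₂₉ B₃ B₃' a₀ a₁).toStage3Params Mstar ops)) ∧
        (B11Leaf (Z11OfRecord F 2 ζ)) ∧
        (PrintedUV3V 2 (theta13OfThm1CCMW F 2 j γ ε₀ ε₂₉ B₃ B₃' a₀ a₁).L) ∧
        (∀ P : B12.RunParams, B12Sec2to5.Lemma4Printed (F12OfRecord₁₂ F 2 (theta13OfThm1CCMW F 2 j γ ε₀ ε₂₉ B₃ B₃' a₀ a₁).toStage12Params lam12 P) (lam12 P).consts) ∧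
        (∀ P : B12.RunParams, (leavesP w P).smallCouplings → (leavesP w P).smallFieldInductive) ∧
        (∀ P : B12.RunParams, B13LeafOfRecord (theta13OfThm1CCMW F 2 j γ ε₀ ε₂₉ B₃ B₃' a₀ a₁).toStage3Params (lam13 P)) ∧
        (∀ P : B12.RunParams, (leavesP w P).b7 → (leavesP w P).b8 → (leavesP w P).b9 → (leavesP w P).b10 → (leavesP w P).b11 →
      (leavesP w P).smallCouplings → (leavesP w P).smallFieldInductive → (leavesP w P).flowControl →
        ∀ k, k < P.K → SLaw₁₃CoPH F 2 (Stage13HParams.ofHistoryBlind F 2 ⟨theta13OfThm1CCMW F 2 j γ ε₀ ε₂₉ B₃ B₃' a₀ a₁, ZrOfRecord₁₃ F 2 (theta13OfThm1CCMW F 2 j γ ε₀ ε₂₉ B₃ B₃' a₀ a₁)⟩) P k → TLaw₁₃CoPH F 2 (Stage13HParams.ofHistoryBlind F 2 ⟨theta13OfThm1CCMW F 2 j γ ε₀ ε₂₉ B₃ B₃' a₀ a₁, ZrOfRecord₁₃ F 2 (theta13OfThm1CCMW F 2 j γ ε₀ ε₂₉ B₃ B₃' a₀ a₁)⟩) P k)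 ∧
        (∀ P : B12.RunParams, B15Leaf (WOfRecord₁₃ F 2 (theta13OfThm1CCMW F 2 j γ ε₀ ε₂₉ B₃ B₃' a₀ a₁) lamW P)) ∧
        (∀ P : B12.RunParams, (genFlow (betaOfRecord₁₃ F 2 (theta13OfThm1CCMW F 2 j γ ε₀ ε₂₉ B₃ B₃' a₀ a₁)) P.g0).InInterval w.γ P.K → ∀ k, k ≤ P.K → SLaw₁₃CoPH F 2 (Stage13HParams.ofHistoryBlind F 2 ⟨theta13OfThm1CCMW F 2 j γ ε₀ ε₂₉ B₃ B₃' a₀ a₁, ZrOfRecord₁₃ F 2 (theta13OfThm1CCMW F 2 j γ ε₀ ε₂₉ B₃ B₃' a₀ a₁)⟩) P k →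
      ∀ U : GaugeField (F.P P.K) k (SU 2),
        chiβOfRecord₁₃ F 2 (theta13OfThm1CCMW F 2 j γ ε₀ ε₂₉ B₃ B₃' a₀ a₁) P.K (gOfRecord₁₃ F 2 (theta13OfThm1CCMW F 2 j γ ε₀ ε₂₉ B₃ B₃' a₀ a₁) P) k U *
              Real.exp (-(1 / (gOfRecord₁₃ F 2 (theta13OfThm1CCMW F 2 j γ ε₀ ε₂₉ B₃ B₃' a₀ a₁) P k) ^ 2 * wilsonBGOfRecord F 2 (theta13OfThm1CCMW F 2 j γ ε₀ ε₂₉ B₃ B₃' a₀ a₁).εbg P k U)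
                - w.em (gOfRecord₁₃ F 2 (theta13OfThm1CCMW F 2 j γ ε₀ ε₂₉ B₃ B₃' a₀ a₁) P k) * (Fintype.card (Site (F.P P.K) k) : ℝ)) ≤ densOfRecord₁₃ F 2 (theta13OfThm1CCMW F 2 j γ ε₀ ε₂₉ B₃ B₃' a₀ a₁) P k U ∧
        densOfRecord₁₃ F 2 (theta13OfThm1CCMW F 2 j γ ε₀ ε₂₉ B₃ B₃' a₀ a₁) P k U ≤ Real.exp (w.ep (gOfRecord₁₃ F 2 (theta13OfThm1CCMW F 2 j γ ε₀ ε₂₉ B₃ B₃' a₀ a₁) P k) * (Fintype.card (Site (F.P P.K) k) : ℝ))) ∧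
        (∀ P : B12.RunParams, 1 ≤ P.K → lamW.kSel P < P.K)) :
    ∃ (θ : Stage13HParams F 2) (hP : θ.Provisos₁₃SepCoPH F 2) (w : WorldP), (θ.ZhUnity F 2 ∧ θ.SlotsNondegenerate₁₃ F 2) ∧ θ.Admissible F 2 ∧
      (∃ (θ' : Stage13HParams F 2) (h' : θ'.Provisos₁₃SepCoPH F 2), θ'.Admissible F 2 ∧
      datumOfRecord₁₃SepCoPH F 2 θ hP = datumOfRecord₁₃SepCoPH F 2 θ' h' ∧ w.C = (datumOfRecord₁₃SepCoPH F 2 θ hP).C ∧ (0 < w.γ ∧ w.γ ≤ θ'.γ) ∧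
      w.L = (θ'.L : ℝ) ∧ ∀ P : B12.RunParams, w.up P = upOfRecord₅CS F 2 (θ'.toStage5₁₃CoPH F 2) P) ∧
      (∀ P : B12.RunParams, Nodes (leavesP w P)) ∧ PrintedUV3V 2 θ.L ∧
      ∃ lam : ResidW F 2, (∀ P : B12.RunParams, 1 ≤ P.K → lam.kSel P < P.K) ∧
        ∀ P : B12.RunParams, lam.kSel P < P.K → ((leavesP w P).rBasicStep ↔ B15Leaf (WOfRecord₁₃ F 2 θ.toStage13Params lam P)) := by
  obtain ⟨B₃, a₀, a₁, hB₃, ha₀, ha₁, h8⟩ := h1F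
  have hL0 : (0 : ℝ) < (F.L : ℝ) := by exact_mod_cast lt_trans Nat.zero_lt_one F.hL.2
  have hBpos : (0 : ℝ) < B₃ := lt_of_lt_of_le (mul_pos two_pos (pow_pos hL0 2)) hB₃
  obtain ⟨j, c, B₉, a₁', hc, hB9, ha₁', ha₁'le, h9⟩ := gauge9Supplier_of_prop6MemberP F h2PF B₃ a₀ a₁ hB₃ ha₀ ha₁ h8
  have h15 : VariationalThm1RegSepCoP7M F 2 B₃ a₀ a₁' := variationalThm1RegSepCoP7M_of_prop8TopStep hBpos (h8.of_le le_rfl ha₁'le)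
  obtain ⟨γ₀, ε₀, ε₂₉, β', hγ0, hε, hε', hlow, hup⟩ := h3A'F j c B₃ B₉ a₀ a₁' hc hB₃ hB9 ha₀ ha₁' h15 h9
  obtain ⟨γ, hγpos, hγh, hl, hu, hlow', hup'⟩ := windowLetters_of_absBetaBoxH hγ0 hlow hup
  have hloW := betaLowerH_theta13OfThm1CCMW_of_half (F := F) (N := 2) (j := j) (ε₀ := ε₀) (ε₂₉ := ε₂₉) (B₃ := B₃) (B₃' := B₉) (a₀ := a₀) (a₁ := a₁') hγh hlow'
  have hupW := betaUpperH_theta13OfThm1CCMW_of_half (F := F) (N := 2) (j := j) (ε₀ := ε₀) (ε₂₉ := ε₂₉) (B₃ := B₃) (B₃' := B₉) (a₀ := a₀) (a₁ := a₁') hγh hup'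
  obtain ⟨lam8, lam12, lam13, Mstar, ops, ζ, lamW, w, hC, hγ, hL, hupv, h05, h06, h07, h08, h09, h09T, h10, h11, h12, hUV, hK⟩ :=
    hchildren hγpos hγh hε hε' hBpos.le hB9.le ha₀ ha₁' h15 hc h9 hloW hupW hl hu
  exact N24_nodesAtSomeRecordS₁₃SepCoPH_of_pinX3HS_fourPin_pointed_theta13OfThm1CCMW_of_gauge9TopStepR_of_betaBoxSignFree_allTorus_door hγpos hγh hε hε' hBpos.le hB9.le ha₀ ha₁' h15 hc h9 hloW hupW hl hu lam8 lam12 lam13 Mstar ops ζ lamW w hC hγ hL hupv h05 h06 h07 h08 h09 h09T h10 h11 h12 hUV hK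

end Summit.QuantumFields.YangMills.BalabanUVNodes.N24K1ConsequentOfStubsV19AndChildren

end
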